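import Summits.QuantumFields.YangMills.Theorems.FlatTubeReductionDressedHTEventuallyR
import HarnessLib

/-!
# THE DRESSED (B-T) BRICK AT RADIUS `r_B` WITH THE EXPLICIT CONSTANT `c_β = f_β(1)/(2·fpZ(btEps β))` — `dressed_hT_eventually_R_explicit`
# (route `FlatTubeReduction`, crux K1 `NearFlatRatioLaw` stmt-QuantumFields-24720; seat `ym-line-ftr-p1` g17; rate twin «ratepack-v5»; R2b1 RECORD rung — no summit statement is proved here)

WHY (NOTES `## ST-PORT`).  `…DressedHTEventuallyR.dressed_hT_eventually_R` returns its normalisation `c_β` existentially (`∃ c κ, …`), which suffices for the hT field but not for the (B-ST)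
port: lane A's stiff gap comes with the constant `Λ_A = (btC/fpZ/γ_A)·λ₀`, and transferring it to the rate twin's `σ_β = c_β/γ_β` needs `Λ_A ≤ σ_β·λ₀·(1+o(1))`, i.e. the VALUE
`c_β = fpBOKernel(Ω₀ β, fpWeight (btEps β))(1,1)/K_{L³β}(1,1)/2/fpZ(btEps β)` (then `btC ≤ f_β(1)` by `…StiffTransfer.btC_le_diag` and `γ_A ≥ mass(1)(1 − aλ_b²)` by
`…FibreMassPointwiseRecordR`).  Same proof as the landed theorem (verbatim up to the final packaging), with `c_β` kept explicit and its eventual positivity exported.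
  ★★★ `dressed_hT_eventually_R_explicit`.
HONEST FRAMING: a restatement of a landed brick with its constant exposed (same proof); femto rung R2b1 (RECORD label); not infinite volume, not a gap, not Clay.  No defs, no named
facts, no `sorry`.
-/


set_option autoImplicit false

noncomputable section

open MeasureTheory Filter Topology Real
open scoped BigOperators Matrix Quaternion
open Literature.MathematicalPhysics.QuantumFieldTheory
open Literature.MathematicalPhysics.QuantumLattice

namespace Summit.QuantumFields.YangMills.Theorems.FemtoTransferGap.TwoLattice.ConstTube

open Summit.QuantumFields.YangMills.Theorems.FemtoTransferGap
open Summit.QuantumFields.YangMills.Theorems.FemtoTransferGap.TwoLattice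
open Summit.QuantumFields.YangMills.Theorems.FemtoTransferGap.TwoLattice.Avg
open Summit.QuantumFields.YangMills.Theorems.FemtoTransferGap.TwoLattice.Stiff (LinkSpace)
open Summit.QuantumFields.YangMills.Theorems.FemtoTransferGap.TwoLattice.Cov

variable {L : ℕ} [NeZero L]

set_option maxHeartbeats 3200000 in
-- as in `…DressedHTEventually` (3.2M there): one long eventual assembly with many opaque abbreviations.
/-- ★★★ **THE DRESSED (B-T) BRICK AT FIBRE RADIUS `β^{-1/2}·log β`, WITH THE EXPLICIT CONSTANT** `c_β = f_β(1)/(2·fpZ(btEps β))`,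
`f_β(1) = fpBOKernel(Ω₀ β, fpWeight (btEps β))(1,1)/K_{L³β}(1,1)`: same hypotheses as `dressed_hT_eventually_R`; conclusion `∃ κ ≥ 0, κ = O(λ_b²)` and EVENTUALLY `0 < c_β` and
`|tubeForm β (boFunAd φ (n_β·Ω₀_β)) − c_β·Q_{L³β}(φW_β)| ≤ κ_β·c_β·(Q_{L³β}(φW_β) + λ₀(1,L³β)‖φ‖²)` for every admissible `φ` (the landed theorem hides `c_β` behind an existential; the (B-ST)
port compares it with lane A's `btC/fpZ`). [cite: Luscher1983, §3] -/
theorem dressed_hT_eventually_R_explicit {D : ℝ} (hD : 1 ≤ D) {Ω₀ : ℝ → LinkSpace L → ℝ}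
    (hΩm : ∀ β, Measurable (Ω₀ β)) (hΩ0 : ∀ β x, 0 ≤ Ω₀ β x) (hΩ1 : ∀ β x, Ω₀ β x ≤ 1) (hΩinv : ∀ β (g : SU2) (x : LinkSpace L), Ω₀ β (adL L g x) = Ω₀ β x)
    (hΩs : ∀ β (v : Edge 3 L → Fin 3 → ℝ), Ω₀ β (linkEmbed L v) ≠ 0 →
      v ∈ capBalancedSet L ∧ ‖linkEmbed L v‖ ≤ btLog β * powScale (1 / 2) β ∧ ∀ (e : Edge 3 L) (c : Fin 3), |v e c| ≤ btLog β * powScale (1 / 2) β)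
    (hθ : ∀ᶠ β : ℝ in atTop, 0 < ∫ v, Ω₀ β (linkEmbed L v) ∂orthoTransverse L)
    {n m W : ℝ → GaugeConfig 3 1 SU2 → ℝ} {εW : ℝ → ℝ} {κN CW κW : ℝ}
    (hnm : ∀ β, Measurable (n β)) (hn01 : ∀ β u, 0 ≤ n β u ∧ n β u ≤ 1) (hng : ∀ β (g : Site 3 1 → SU2) (u : GaugeConfig 3 1 SU2), n β (gaugeTransform g u) = n β u)
    (hWphys : ∀ β, IsPhys (W β)) (hW0 : ∀ β u, 0 ≤ W β u) (hWC : ∀ β u, |W β u| ≤ CW) (hκW : 0 ≤ κW) (hκN : 0 ≤ κN)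
    (hWsq : ∀ β u, orbitDist u < D * recordDelta1 L (1 / 6) β → |W β u ^ 2 - 1| ≤ κW * orbitDist u ^ 2)
    (hεW : ∃ a' : ℝ, ∀ᶠ β : ℝ in atTop, εW β ≤ a' * bareLambda ((L : ℝ) ^ 3 * β) ^ 2)
    (hwin : ∀ᶠ β : ℝ in atTop, ∀ u : GaugeConfig 3 1 SU2, orbitDist u < D * recordDelta1 L (1 / 6) β →
      |W β u ^ 2 - fpBOKernel L β (Ω₀ β) (fpWeight L β⁻¹) u u / transferKernel su2Rep ((L : ℝ) ^ 3 * β) u u /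
          (fpBOKernel L β (Ω₀ β) (fpWeight L β⁻¹) 1 1 / transferKernel su2Rep ((L : ℝ) ^ 3 * β) (1 : GaugeConfig 3 1 SU2) 1) / m β u| ≤ εW β ∧
        |m β u - 1| ≤ κN * orbitDist u ^ 2 + εW β ∧ 0 < m β u ∧ n β u ^ 2 * m β u = 1 / 2) :
    ∃ κ : ℝ → ℝ, (∀ β, 0 ≤ κ β) ∧ (∃ a : ℝ, ∀ᶠ β : ℝ in atTop, κ β ≤ a * bareLambda ((L : ℝ) ^ 3 * β) ^ 2) ∧
      ∀ᶠ β : ℝ in atTop, 0 < fpBOKernel L β (Ω₀ β) (fpWeight L (btEps β)) 1 1 / transferKernel su2Rep ((L : ℝ) ^ 3 * β) (1 : GaugeConfig 3 1 SU2) 1 / 2 / fpZ (btEps β) ∧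
      ∀ φ : GaugeConfig 3 1 SU2 → ℝ, Measurable φ → (∃ C : ℝ, ∀ u, |φ u| ≤ C) →
        (∀ (g : Site 3 1 → SU2) (u : GaugeConfig 3 1 SU2), φ (gaugeTransform g u) = φ u) → (∀ u, φ u ≠ 0 → orbitDist u < D * recordDelta1 L (1 / 6) β) →
        |tubeForm β (RateTube.boFunAd L φ (fun u x => n β u * Ω₀ β x)) -
            fpBOKernel L β (Ω₀ β) (fpWeight L (btEps β)) 1 1 / transferKernel su2Rep ((L : ℝ) ^ 3 * β) (1 : GaugeConfig 3 1 SU2) 1 / 2 / fpZ (btEps β) * qform su2Rep ((L : ℝ) ^ 3 * β) (fun u => φ u * W β u) (fun u => φ u * W β u)| ≤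
          κ β * (fpBOKernel L β (Ω₀ β) (fpWeight L (btEps β)) 1 1 / transferKernel su2Rep ((L : ℝ) ^ 3 * β) (1 : GaugeConfig 3 1 SU2) 1 / 2 / fpZ (btEps β)) *
            (qform su2Rep ((L : ℝ) ^ 3 * β) (fun u => φ u * W β u) (fun u => φ u * W β u) + levelValue su2Rep 1 ((L : ℝ) ^ 3 * β) 0 * l2 φ φ) := by
  classical
  have hL1 : (1 : ℝ) ≤ L := by exact_mod_cast NeZero.one_le
  have hN0 : (0 : ℝ) < (Fintype.card (Site 3 L) : ℝ) := by exact_mod_cast Fintype.card_pos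
  have hN1 : (1 : ℝ) ≤ (Fintype.card (Site 3 L) : ℝ) := by exact_mod_cast Fintype.card_pos
  have hCW0 : 0 ≤ CW := (abs_nonneg _).trans (hWC 0 1)
  have hΩ1' : ∀ β x, |Ω₀ β x| ≤ 1 := fun β x => by rw [abs_of_nonneg (hΩ0 β x)]; exact hΩ1 β x
  -- the rate constants
  obtain ⟨a₁, hκ₀ev⟩ := eventually_symKappaR_le_bareLambda_sq (L := L) hD
  obtain ⟨a', hεWa⟩ := hεW
  obtain ⟨a₂, ha₂def⟩ : ∃ a₂ : ℝ, a₂ = ((Fintype.card (Site 3 L) : ℝ) / 14) ^ 4 * ((14 * 1 / Fintype.card (Site 3 L)) ^ 2 * L / (2 : ℝ) ^ ((1 : ℝ) / 3)) ^ 2 := ⟨_, rfl⟩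
  have ha₂0 : 0 ≤ a₂ := by rw [ha₂def]; positivity
  obtain ⟨aT, haT⟩ : ∃ aT : ℝ, aT = (9 / 4 * max a₁ 0 + 5 * max a' 0) * (1 + CW ^ 2) + 2 * a₂ := ⟨_, rfl⟩
  have haT0 : 0 ≤ aT := by rw [haT]; positivity
  -- smallness of `δ`, `ε_W`
  have hδt : Tendsto (fun β : ℝ => D * recordDelta1 L (1 / 6) β) atTop (𝓝 0) := by
    simpa using (tendsto_recordDelta1 (L := L) (show (0 : ℝ) < 1 / 6 by norm_num)).const_mul D
  have hsmall := RateTube.mul_bareLambda_sq_eventually_le (L := L) (le_max_right a' 0)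
  -- ★ the fixed-`β` statement on the good set
  have main : ∀ᶠ β : ℝ in atTop, 0 < fpBOKernel L β (Ω₀ β) (fpWeight L (btEps β)) 1 1 / transferKernel su2Rep ((L : ℝ) ^ 3 * β) (1 : GaugeConfig 3 1 SU2) 1 / 2 / fpZ (btEps β) ∧
      ∀ φ : GaugeConfig 3 1 SU2 → ℝ, Measurable φ → (∃ C : ℝ, ∀ u, |φ u| ≤ C) →
        (∀ (g : Site 3 1 → SU2) (u : GaugeConfig 3 1 SU2), φ (gaugeTransform g u) = φ u) → (∀ u, φ u ≠ 0 → orbitDist u < D * recordDelta1 L (1 / 6) β) →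
        |tubeForm β (RateTube.boFunAd L φ (fun u x => n β u * Ω₀ β x)) -
            fpBOKernel L β (Ω₀ β) (fpWeight L (btEps β)) 1 1 / transferKernel su2Rep ((L : ℝ) ^ 3 * β) (1 : GaugeConfig 3 1 SU2) 1 / 2 / fpZ (btEps β) * qform su2Rep ((L : ℝ) ^ 3 * β) (fun u => φ u * W β u) (fun u => φ u * W β u)| ≤
          aT * bareLambda ((L : ℝ) ^ 3 * β) ^ 2 * (fpBOKernel L β (Ω₀ β) (fpWeight L (btEps β)) 1 1 / transferKernel su2Rep ((L : ℝ) ^ 3 * β) (1 : GaugeConfig 3 1 SU2) 1 / 2 / fpZ (btEps β)) *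
            (qform su2Rep ((L : ℝ) ^ 3 * β) (fun u => φ u * W β u) (fun u => φ u * W β u) + levelValue su2Rep 1 ((L : ℝ) ^ 3 * β) 0 * l2 φ φ) := by
    filter_upwards [eventually_scheduleR_facts (L := L) hD, eventually_marginsR (L := L) hD, eventually_coreEps_sum_le_one_R (L := L) hD, eventually_coreEta_le_one_R (L := L) hD,
      eventually_symEtaR_le_one (L := L) hD, eventually_dressed_budget_R (L := L) hD, hκ₀ev, hεWa, hsmall, hwin, hθ,
      eventually_mul_le_of_tendsto hδt κW (by norm_num : (0 : ℝ) < 1 / 4), eventually_mul_le_of_tendsto hδt κN (by norm_num : (0 : ℝ) < 1 / 4)]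
      with β hf hmar hεsum hηd hηs hbud hκ₀β hεWβ hsm hwinβ hθβ hκWδ hκNδ
    obtain ⟨hβ1, hℓeq, hℓ1, hδ0, -, hδ2, hx0, hx1, -, -, -, hT30, -, htT, -, -, hσ2, -, -, -, hα0, -, -, hα30, -, hεx⟩ := hf
    obtain ⟨hLa, hm₁, hm₂, hP, hP0, hJ⟩ := hmar
    obtain ⟨hB1, hB2, hρR, hκℓ, H1, H1', H2, H3⟩ := hbud
    have hβ0 : 0 ≤ β := by linarith
    have hℓ0 : 0 ≤ btLog β := by linarith
    have hxl0 : 0 ≤ btLog β * powScale (1 / 2) β := by positivity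
    have hxl20 : 0 ≤ powScale (1 / 2) β * btLog β ^ 2 := by positivity
    have hxle : btLog β * powScale (1 / 2) β ≤ 1 / 30 := htT.trans hT30
    have hε0 : 0 < btEps β := (btEps_pos_le β).1
    have hδpos : 0 < D * recordDelta1 L (1 / 6) β := by
      unfold recordDelta1; exact mul_pos (by linarith) (div_pos (mul_pos (by norm_num) (powScale_pos _ _)) hN0)
    -- the margins in the non-strict form of the fixed-`β` estimate
    have hm₁' : 0 ≤ 5 * (powScale (1 / 2) β * btLog β ^ 2) / 2 - 2 * (Real.sqrt 2 * (btLog β * powScale (1 / 2) β) + D * recordDelta1 L (1 / 6) β) * btEps β -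
        (2 * Real.sqrt 2 * (btLog β * powScale (1 / 2) β) + powScale (1 / 2) β * btLog β ^ 2 / (2 * (L : ℝ) ^ 2)) := le_trans (by positivity) hm₁
    have hm₂' : 0 ≤ 1 / (3 * L) - 4 * (Real.sqrt 2 * (btLog β * powScale (1 / 2) β) + D * recordDelta1 L (1 / 6) β) -
        (2 * Real.sqrt 2 * (btLog β * powScale (1 / 2) β) + powScale (1 / 2) β * btLog β ^ 2 / (2 * (L : ℝ) ^ 2)) := le_trans (by positivity) hm₂
    have hP0' : 0 ≤ 13 * (D * recordDelta1 L (1 / 6) β) - 4 * (Real.sqrt 2 * (btLog β * powScale (1 / 2) β) + D * recordDelta1 L (1 / 6) β) -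
        (2 * Real.sqrt 2 * (btLog β * powScale (1 / 2) β) + 2 * (D * recordDelta1 L (1 / 6) β)) := le_trans (by positivity) hP0
    have hJ' : 2 * btEps β * Fintype.card (Site 3 L) * (D * recordDelta1 L (1 / 6) β) + 2 * (btLog β * powScale (1 / 2) β) ^ 2 +
        2 * Real.sqrt 2 * Fintype.card (Site 3 L) * (9 * L * (13 * (D * recordDelta1 L (1 / 6) β)) + btEps β) * (btLog β * powScale (1 / 2) β) ≤
        Fintype.card (Site 3 L) * (1 - 3 * L * (13 * (D * recordDelta1 L (1 / 6) β))) * (powScale (1 / 2) β * btLog β ^ 2 / (2 * (L : ℝ) ^ 2)) := by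
      have : 0 ≤ (Fintype.card (Site 3 L) : ℝ) * (powScale (1 / 2) β * btLog β ^ 2 / (2 * (L : ℝ) ^ 2)) / 4 := by positivity
      linarith
    -- support of the profile at radius `ℓx`
    have hsupp : ∀ v : Edge 3 L → Fin 3 → ℝ, Ω₀ β (linkEmbed L v) ≠ 0 →
        v ∈ capBalancedSet L ∧ (∀ (e : Edge 3 L) (c : Fin 3), |v e c| ≤ btLog β * powScale (1 / 2) β) ∧ ‖linkEmbed L v‖ ≤ btLog β * powScale (1 / 2) β := fun v hv => by
      obtain ⟨h1, h2, h3⟩ := hΩs β v hv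
      exact ⟨h1, h3, h2⟩
    have hsupp' : ∀ v : Edge 3 L → Fin 3 → ℝ, Ω₀ β (linkEmbed L v) ≠ 0 →
        (∀ (e : Edge 3 L) (c : Fin 3), |v e c| ≤ btLog β * powScale (1 / 2) β) ∧ ‖linkEmbed L v‖ ≤ btLog β * powScale (1 / 2) β := fun v hv => (hsupp v hv).2
    -- the quaternion core `ρ = btEps/3`
    have hρ0 : 0 ≤ btEps β / 3 := by positivity
    have hρε : 2 * (btEps β / 3) < btEps β := by linarith
    have hρ1 : btEps β / 3 < 1 := by linarith [(btEps_pos_le β).2]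
    -- the budget
    have hτ := dressedTau_le hβ0 hB1 hB2 (hΩm β) (hΩ1' β) (hΩ0 β) hsupp' hxle hρ0 hρR hρε hρ1 (powScale_pos 1 β).le hκℓ H1 H1' H2 H3
    -- `𝔉(1,1) > 0` from the relative floor
    have hfw := measurable_fpWeight L (btEps β)
    have ha0 : 0 < fpBOKernel L β (Ω₀ β) (fpWeight L (btEps β)) 1 1 := by
      have hfloor := fpBOKernel_one_one_ge hβ0 (hΩm β) (hΩ1' β) (hΩ0 β) hfw (abs_fpWeight_le L (btEps β)) (fun g => (fpWeight_mem_Icc L (btEps β) g).1) hρ0 hxle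
        (fun g hg => fpWeight_ge_one_of_mem_gaugeCore hρ1 hρε hg) hsupp'
      have hG : 0 < (gaugeMeasure L).real (gaugeCore L (btEps β / 3)) :=
        lt_of_lt_of_le (by positivity) (gaugeMeasure_real_gaugeCore_ge (L := L) (by positivity) hρ1.le)
      have hI : 0 < (∫ v, Ω₀ β (linkEmbed L v) ∂orthoTransverse L) ^ 2 := by positivity
      exact lt_of_lt_of_le (mul_pos (mul_pos (Real.exp_pos _) hG) hI) hfloor
    -- the window facts at this `β`
    have hεinv : btEps β = β⁻¹ := btEps_eq_inv hβ1
    rw [← hεinv] at hwinβ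
    have hεW0 : 0 ≤ εW β := by
      have h := (hwinβ 1 (by rw [show (1 : GaugeConfig 3 1 SU2) = fun _ => (1 : SU2) from rfl, orbitDist_one]; exact hδpos)).1
      exact (abs_nonneg _).trans h
    have hεW4 : εW β ≤ 1 / 4 := by
      have : a' * bareLambda ((L : ℝ) ^ 3 * β) ^ 2 ≤ max a' 0 * bareLambda ((L : ℝ) ^ 3 * β) ^ 2 := mul_le_mul_of_nonneg_right (le_max_left _ _) (sq_nonneg _)
      linarith
    have hwin' : ∀ u : GaugeConfig 3 1 SU2, orbitDist u < D * recordDelta1 L (1 / 6) β →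
        |W β u ^ 2 - fpBOKernel L β (Ω₀ β) (fpWeight L (btEps β)) u u / transferKernel su2Rep ((L : ℝ) ^ 3 * β) u u /
            (fpBOKernel L β (Ω₀ β) (fpWeight L (btEps β)) 1 1 / transferKernel su2Rep ((L : ℝ) ^ 3 * β) (1 : GaugeConfig 3 1 SU2) 1) / m β u| ≤ εW β ∧
          n β u ^ 2 * m β u = 1 / 2 ∧ |W β u ^ 2 - 1| ≤ 1 / 2 ∧ |m β u - 1| ≤ 1 / 2 := by
      intro u hu
      obtain ⟨h1, h2, -, h4⟩ := hwinβ u hu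
      have hd0 := orbitDist_nonneg u
      have hd1 : orbitDist u ^ 2 ≤ (D * recordDelta1 L (1 / 6) β) ^ 2 := pow_le_pow_left₀ hd0 hu.le 2
      have hd2 : orbitDist u ^ 2 ≤ D * recordDelta1 L (1 / 6) β := by nlinarith only [hd1, hδ2, hδpos]
      have e1 : κW * orbitDist u ^ 2 ≤ κW * (D * recordDelta1 L (1 / 6) β) := mul_le_mul_of_nonneg_left hd2 hκW
      have e2 : κN * orbitDist u ^ 2 ≤ κN * (D * recordDelta1 L (1 / 6) β) := mul_le_mul_of_nonneg_left hd2 hκN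
      refine ⟨h1, h4, (hWsq β u hu).trans ?_, h2.trans ?_⟩
      · linarith only [e1, hκWδ]
      · linarith only [e2, hκNδ, hεW4]
    -- the fixed-`β` brick (near-pair rate)
    have hα1 : powScale (1 / 2) β * btLog β ^ 2 / (2 * (L : ℝ) ^ 2) ≤ 1 := hα30.trans (by norm_num)
    have h := dressed_hT_fixed_beta_near hβ0 (hΩm β) (hΩ1' β) (hΩ0 β) (hΩinv β) hsupp hδ2 hα0 hα1 hα30 hε0 hxl0 htT hT30 hσ2 hεsum hηd hηs hLa hm₁' hm₂' hP hP0' hJ'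
      (hnm β) (hn01 β) (hng β) (hWphys β) (hW0 β) (hWC β) hεW0 hεW4 hwin' ha0 (powScale_pos 1 β).le hτ
    -- `c > 0` and the uniform rate
    have hc0 : 0 < fpBOKernel L β (Ω₀ β) (fpWeight L (btEps β)) 1 1 / transferKernel su2Rep ((L : ℝ) ^ 3 * β) (1 : GaugeConfig 3 1 SU2) 1 / 2 / fpZ (btEps β) :=
      div_pos (div_pos (div_pos ha0 (transferKernel_pos _ _ _ _)) two_pos) (fpZ_pos hε0)
    have hlam2 : 0 ≤ bareLambda ((L : ℝ) ^ 3 * β) ^ 2 := sq_nonneg _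
    have hy : powScale 1 β ≤ a₂ * bareLambda ((L : ℝ) ^ 3 * β) ^ 2 := by rw [ha₂def]; exact powScale_one_le_mul_bareLambda_sq (L := L) hβ1
    have hκ₀' : _ ≤ max a₁ 0 * bareLambda ((L : ℝ) ^ 3 * β) ^ 2 := hκ₀β.trans (mul_le_mul_of_nonneg_right (le_max_left _ _) hlam2)
    have hεW' : εW β ≤ max a' 0 * bareLambda ((L : ℝ) ^ 3 * β) ^ 2 := hεWβ.trans (mul_le_mul_of_nonneg_right (le_max_left _ _) hlam2)
    refine ⟨hc0, fun φ hφm hφb hφg hs => ?_⟩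
    obtain ⟨Cφ, hCφ⟩ := hφb
    have hφ := h φ hφm hCφ hφg hs
    have hq0 : 0 ≤ qform su2Rep ((L : ℝ) ^ 3 * β) (fun u => φ u * W β u) (fun u => φ u * W β u) :=
      qform_self_nonneg_of_bounded (by positivity) (hφm.mul (hWphys β).measurable) (C := Cφ * CW) fun u => by
        rw [abs_mul]; exact mul_le_mul (hCφ u) (hWC β u) (abs_nonneg _) ((abs_nonneg _).trans (hCφ 1))
    have hS0 : 0 ≤ qform su2Rep ((L : ℝ) ^ 3 * β) (fun u => φ u * W β u) (fun u => φ u * W β u) + levelValue su2Rep 1 ((L : ℝ) ^ 3 * β) 0 * l2 φ φ := by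
      have := levelValue_su2Rep_nonneg 1 (by positivity : (0 : ℝ) ≤ (L : ℝ) ^ 3 * β) 0
      have := l2_self_nonneg φ
      positivity
    calc _ ≤ _ := hφ
      _ ≤ _ := by
        refine mul_le_mul_of_nonneg_right (mul_le_mul_of_nonneg_right ?_ hc0.le) hS0
        have h15 : 1 + 5 * εW β ≤ 9 / 4 := by linarith
        have p1 := mul_le_mul hκ₀' h15 (by linarith) (by positivity)
        have p2 := mul_le_mul_of_nonneg_right (add_le_add p1 (mul_le_mul_of_nonneg_left hεW' (by norm_num : (0 : ℝ) ≤ 5))) (by positivity : (0 : ℝ) ≤ 1 + CW ^ 2)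
        rw [haT]
        linarith [p2, hy]
  -- ★ the function `κ`; `c` stays explicit
  refine ⟨fun β => aT * bareLambda ((L : ℝ) ^ 3 * β) ^ 2, fun β => by positivity, ⟨aT, Eventually.of_forall fun β => le_rfl⟩, ?_⟩
  filter_upwards [main] with β hβ
  exact ⟨hβ.1, fun φ hφm hφb hφg hs => hβ.2 φ hφm hφb hφg hs⟩

end Summit.QuantumFields.YangMills.Theorems.FemtoTransferGap.TwoLattice.ConstTube

end
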